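import Literature.AlgebraicGeometry.HodgeTheory.AbelianVarietyPrimeOrderAutomorphismRotationIntegrality
import HarnessLib

/-!
# Theorem 2.1, the arithmetic of the inverse construction: rotation data `𝐛 : G → ℤ_+` with `Σ_h 𝐛(h)𝐣(h⁻¹) ∈ pℤ` determine a
# nonnegative, integer-valued, admissible `𝐚(v) = (1/p) Σ_u 𝐛(u)𝐣(u⁻¹(−v)) − 1` with `Σ_v 𝐚(v) = (p−1)(Σ𝐛 − 2)/2 = g`

Family `hodge`, lane `lit-hodgefound` (seat p03, GEN 35 «the analytic type of a finite-order automorphism», row g35-#11; sequel of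
g35-#9 `AbelianVarietyPrimeOrderAutomorphismRotationIntegrality` and g35-#6), topic `Literature/AlgebraicGeometry/HodgeTheory`.
Theorems only: no definition, no instance, no named fact (net Literature debt 0).

Zarhin's Theorem 2.1 inverts Theorem 1.4: from `𝐛 : G = (ℤ/pℤ)^* → ℤ_+` with (i) `Σ_h 𝐛(h) = 2g/(p−1) + 2` and (ii)
`Σ_h 𝐛(h)𝐣(h⁻¹) ∈ pℤ` he builds the superelliptic Jacobian `(𝒥, δ)` with `dim 𝒥 = g` (a), `Σ_{j<p} δ^j = 0` (b) and
multiplicity function `𝐚(v) = ((p−1)/p)·𝐛 ∗ 𝐣(−v) − 1` (c).  The geometric steps (the curve `y^p = f_𝐛(x)`, its genus, the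
rotation numbers `ε_P = ζ_p^{𝐣(h)}`, Proposition 1.11) are not available in the tree; this file proves the ARITHMETIC that makes
(a)–(c) consistent: for any `𝐛 : G → ℤ_+`, not identically zero, satisfying (ii), every sum `S(v) = Σ_u 𝐛(u)𝐣(u⁻¹(−v))` is a
POSITIVE MULTIPLE OF `p` (Corollary 1.15 + `𝐣 ≥ 1`), so formula (c) defines a unique `𝐚 : G → ℤ_+` with `p(𝐚(v) + 1) = S(v)`;
this `𝐚` is admissible, `𝐚(v) + 𝐚(−v) = Σ𝐛 − 2` (`= 2g/(p−1)` under (i)), and `Σ_v 𝐚(v) = (p−1)(Σ𝐛 − 2)/2` (`= g` under (i),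
matching (a)) because `Σ_{v∈G} 𝐣(v) = p(p−1)/2`.

## Sources, verbatim (held text `paper:arxiv-2109.06794`)

Yu. G. Zarhin, *Jacobians with automorphisms of prime order*, Math. Research Reports (2021) = arXiv:2109.06794, §2 (chunk p0006
L3–L60) «The following theorem may be viewed as an inverse of Theorem 1.4. **Theorem 2.1.** Let `g` be a positive integer, `p` an odd
prime […] Suppose that `(p−1)` divides `2g`. Let `𝐛 : G → ℤ_+` be a non-negative integer-valued function such that (i)
`Σ_{h∈G} 𝐛(h) = 2g/(p−1) + 2`. (ii) `𝐛 ∗ 𝐣(1 mod p) = Σ_{h∈G} 𝐛(h)𝐣(h⁻¹) ∈ pℤ`. […] Then `𝒥` and `δ` enjoy the following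
properties. (a) `dim(𝒥) = g` (b) `Σ_{j=0}^{p−1} δ^j = 0` in `End(𝒥)`. (c) Let `𝐚 : G → ℤ_+` be the corresponding multiplicity function
[…] Then `𝐚(v) = ((p−1)/p)·𝐛 ∗ 𝐣(−v) − 1 ∀ v ∈ G`»; §1 Def. 1.1 / (1.2) (chunk p0003 L47, L74–L80) «`Σ_{h∈G} 𝐚(h) = g`»,
«admissible: `𝐚(h) + 𝐚(−h) = 2g/(p−1)`»; Cor. 1.15 (chunk p0005 L133–L150), as formalized in g35-#9.

## What is proved (namespace `Literature.AlgebraicGeometry.HodgeTheory.PrimeOrderRotation`; `p` prime, `G = (ZMod p)ˣ`,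
`𝐣(h) = (h : ZMod p).val`, `𝐛 : G → ℕ`)

* `sum_val_units_mul_two` (`2·Σ_{v∈G} 𝐣(v) = p(p−1)`), `sum_val_inv_mul_neg_eq` (`Σ_v 𝐣(u⁻¹(−v)) = Σ_v 𝐣(v)`),
  `sum_sum_mul_val_mul_two` (`2·Σ_v Σ_u 𝐛(u)𝐣(u⁻¹(−v)) = (Σ_u 𝐛(u))·p(p−1)`), `sum_mul_val_add_sum_mul_val_eq` (`S(v) + S(−v) = pΣ𝐛`).
* under (ii) `p ∣ Σ_u 𝐛(u)𝐣(u⁻¹)` and `Σ𝐛 ≠ 0`: **`dvd_and_le_sum_mul_val_of_integral`** (`p ∣ S(v)` and `p ≤ S(v)` for all `v`),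
  **`existsUnique_inverse_of_integral`** (`∃! 𝐚 : G → ℕ, ∀ v, p(𝐚(v)+1) = S(v)` — formula (c) defines nonnegative integers).
* for any `𝐚 : G → ℕ` with `∀ v, p(𝐚(v)+1) = S(v)`: **`add_neg_add_two_eq_sum_of_inverse`** (`𝐚(v) + 𝐚(−v) + 2 = Σ𝐛`: admissible),
  **`two_mul_sum_add_eq_of_inverse`** (`2Σ_v 𝐚(v) + 2(p−1) = (p−1)Σ𝐛`), and under (i) `(Σ𝐛)(p−1) = 2g + 2(p−1)`:
  **`add_neg_mul_eq_of_inverse`** (`(𝐚(v) + 𝐚(−v))(p−1) = 2g`, Def. 1.1) and **`sum_eq_of_inverse`** (`Σ_v 𝐚(v) = g`, (1.2)/(a)).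

## References

* [Zarhin2021PrimeOrderJacobians] Yu. G. Zarhin, Math. Research Reports (2021), arXiv:2109.06794, §2 Thm. 2.1 (chunk p0006), §1
  Def. 1.1, (1.2), Cor. 1.15 (chunks p0003, p0005).
-/

namespace Literature.AlgebraicGeometry.HodgeTheory

namespace PrimeOrderRotation

section Inverse

variable {p : ℕ} [hp : Fact p.Prime]

/-- **`2·Σ_{v∈G} 𝐣(v) = p(p−1)`**: `Σ_{j=1}^{p−1} j = p(p−1)/2`. [cite: Zarhin2021PrimeOrderJacobians, §1 (1.5) (chunk p0003 L106–L108)] -/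
theorem sum_val_units_mul_two : (∑ v : (ZMod p)ˣ, (v : ZMod p).val) * 2 = p * (p - 1) := by
  rw [show (∑ v : (ZMod p)ˣ, (v : ZMod p).val) = ∑ j ∈ Finset.Ico 1 p, j from sum_units_eq_sum_Ico (fun j ↦ j)]
  have h := Finset.sum_range_id_mul_two p
  rwa [Finset.sum_range_eq_add_Ico _ hp.out.pos, zero_add] at h

/-- `Σ_v 𝐣(u⁻¹(−v)) = Σ_v 𝐣(v)`: `v ↦ u⁻¹(−v)` permutes `G`. [cite: Zarhin2021PrimeOrderJacobians, §1 proof of Prop. 1.11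
(«substitution `v = hu`», chunk p0004 L138–L140)] -/
theorem sum_val_inv_mul_neg_eq (u : (ZMod p)ˣ) :
    ∑ v : (ZMod p)ˣ, ((u⁻¹ * -v : (ZMod p)ˣ) : ZMod p).val = ∑ v : (ZMod p)ˣ, (v : ZMod p).val := by
  refine Fintype.sum_equiv ((Equiv.neg (ZMod p)ˣ).trans (Equiv.mulLeft u⁻¹)) _ _ fun v ↦ ?_
  simp only [Equiv.trans_apply, Equiv.neg_apply, Equiv.coe_mulLeft]

/-- **`2·Σ_v Σ_u 𝐛(u)𝐣(u⁻¹(−v)) = (Σ_u 𝐛(u))·p(p−1)`.** [cite: Zarhin2021PrimeOrderJacobians, §2 Thm. 2.1 (c) with (a) (chunk p0006 L40–L60)] -/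
theorem sum_sum_mul_val_mul_two (b : (ZMod p)ˣ → ℕ) :
    (∑ v : (ZMod p)ˣ, ∑ u : (ZMod p)ˣ, b u * ((u⁻¹ * -v : (ZMod p)ˣ) : ZMod p).val) * 2 =
      (∑ u : (ZMod p)ˣ, b u) * (p * (p - 1)) := by
  rw [Finset.sum_comm, Finset.sum_mul, Finset.sum_mul]
  refine Finset.sum_congr rfl fun u _ ↦ ?_
  rw [← Finset.mul_sum, sum_val_inv_mul_neg_eq, mul_assoc, sum_val_units_mul_two]

/-- **`S(v) + S(−v) = p·Σ𝐛`** with `S(v) = Σ_u 𝐛(u)𝐣(u⁻¹(−v))` (`𝐣(w) + 𝐣(−w) = p`).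
[cite: Zarhin2021PrimeOrderJacobians, §1 Def. 1.1, Rem. 1.12 (chunk p0003 L64–L80, p0005 L14–L30)] -/
theorem sum_mul_val_add_sum_mul_val_eq (b : (ZMod p)ˣ → ℕ) (v : (ZMod p)ˣ) :
    ∑ u : (ZMod p)ˣ, b u * ((u⁻¹ * -v : (ZMod p)ˣ) : ZMod p).val +
      ∑ u : (ZMod p)ˣ, b u * ((u⁻¹ * - -v : (ZMod p)ˣ) : ZMod p).val = p * ∑ u : (ZMod p)ˣ, b u := by
  rw [← Finset.sum_add_distrib, Finset.mul_sum]
  refine Finset.sum_congr rfl fun u _ ↦ ?_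
  rw [neg_neg, ← mul_add, mul_neg, add_comm, val_add_val_neg, mul_comm]

/-- **Under (ii) `p ∣ Σ_u 𝐛(u)𝐣(u⁻¹)` and `𝐛 ≠ 0`: every `S(v) = Σ_u 𝐛(u)𝐣(u⁻¹(−v))` is a positive multiple of `p`** —
divisible by Corollary 1.15, positive since `S(v) ≥ Σ𝐛 ≥ 1`; hence `S(v) ≥ p` and formula (c) gives `𝐚(v) = S(v)/p − 1 ≥ 0`.
[cite: Zarhin2021PrimeOrderJacobians, §2 Thm. 2.1 (ii), (c) (chunk p0006 L19–L60), §1 Cor. 1.15 (chunk p0005 L133–L150)] -/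
theorem dvd_and_le_sum_mul_val_of_integral (b : (ZMod p)ˣ → ℕ)
    (hii : p ∣ ∑ u : (ZMod p)ˣ, b u * ((u⁻¹ : (ZMod p)ˣ) : ZMod p).val) (hb : ∑ u : (ZMod p)ˣ, b u ≠ 0) (v : (ZMod p)ˣ) :
    p ∣ ∑ u : (ZMod p)ˣ, b u * ((u⁻¹ * -v : (ZMod p)ˣ) : ZMod p).val ∧
      p ≤ ∑ u : (ZMod p)ˣ, b u * ((u⁻¹ * -v : (ZMod p)ˣ) : ZMod p).val := by
  have hdvd : p ∣ ∑ u : (ZMod p)ˣ, b u * ((u⁻¹ * -v : (ZMod p)ˣ) : ZMod p).val := by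
    have hii' : (p : ℤ) ∣ ∑ u : (ZMod p)ˣ, (b u : ℤ) * (((u⁻¹ : (ZMod p)ˣ) : ZMod p).val : ℤ) := by
      exact_mod_cast hii
    have h := (dvd_sum_mul_val_inv_iff (fun u ↦ (b u : ℤ))).1 hii' (-v)
    have e : ∀ x : (ZMod p)ˣ, -v * x⁻¹ = x⁻¹ * -v := fun x ↦ mul_comm _ _
    simp only [e] at h
    have h' : (p : ℤ) ∣ ((∑ u : (ZMod p)ˣ, b u * ((u⁻¹ * -v : (ZMod p)ˣ) : ZMod p).val : ℕ) : ℤ) := by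
      rw [Nat.cast_sum]
      simp only [Nat.cast_mul]
      exact h
    exact Int.natCast_dvd_natCast.1 h'
  refine ⟨hdvd, Nat.le_of_dvd ?_ hdvd⟩
  have hle : ∑ u : (ZMod p)ˣ, b u ≤ ∑ u : (ZMod p)ˣ, b u * ((u⁻¹ * -v : (ZMod p)ˣ) : ZMod p).val :=
    Finset.sum_le_sum fun u _ ↦ Nat.le_mul_of_pos_right _ (Nat.pos_of_ne_zero (val_units_ne_zero _))
  omega

/-- **Formula (c) defines a unique `𝐚 : G → ℤ_+` with `p·(𝐚(v) + 1) = Σ_u 𝐛(u)𝐣(u⁻¹(−v))`** — i.e. `𝐚(v) = ((p−1)/p)·𝐛 ∗ 𝐣(−v) − 1`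
is a nonnegative integer for every `v` — whenever `𝐛 ≠ 0` satisfies (ii). [cite: Zarhin2021PrimeOrderJacobians, §2 Thm. 2.1 (ii), (c)
(chunk p0006 L19–L60)] -/
theorem existsUnique_inverse_of_integral (b : (ZMod p)ˣ → ℕ)
    (hii : p ∣ ∑ u : (ZMod p)ˣ, b u * ((u⁻¹ : (ZMod p)ˣ) : ZMod p).val) (hb : ∑ u : (ZMod p)ˣ, b u ≠ 0) :
    ∃! a : (ZMod p)ˣ → ℕ, ∀ v : (ZMod p)ˣ,
      p * (a v + 1) = ∑ u : (ZMod p)ˣ, b u * ((u⁻¹ * -v : (ZMod p)ˣ) : ZMod p).val := by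
  refine ⟨fun v ↦ (∑ u : (ZMod p)ˣ, b u * ((u⁻¹ * -v : (ZMod p)ˣ) : ZMod p).val) / p - 1, fun v ↦ ?_, fun a ha ↦ ?_⟩
  · obtain ⟨⟨q, hq⟩, hle⟩ := dvd_and_le_sum_mul_val_of_integral b hii hb v
    dsimp only
    rw [hq, Nat.mul_div_cancel_left _ hp.out.pos]
    have hq1 : 1 ≤ q := by
      by_contra h0
      have : q = 0 := by omega
      rw [this, mul_zero] at hq
      have := hp.out.pos
      omega
    rw [Nat.sub_add_cancel hq1]
  · funext v
    obtain ⟨⟨q, hq⟩, -⟩ := dvd_and_le_sum_mul_val_of_integral b hii hb v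
    have h := ha v
    rw [hq] at h ⊢
    rw [Nat.mul_div_cancel_left _ hp.out.pos]
    have h' : a v + 1 = q := Nat.eq_of_mul_eq_mul_left hp.out.pos h
    omega

/-- **Admissibility of the inverse: `𝐚(v) + 𝐚(−v) + 2 = Σ_u 𝐛(u)`** for any `𝐚 : G → ℤ_+` with `p(𝐚(v)+1) = S(v)` (so under (i):
`𝐚(v) + 𝐚(−v) = 2g/(p−1)`, Definition 1.1). [cite: Zarhin2021PrimeOrderJacobians, §1 Def. 1.1 (chunk p0003 L74–L80), §2 Thm. 2.1 (c) (chunk p0006 L52–L60)] -/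
theorem add_neg_add_two_eq_sum_of_inverse (b a : (ZMod p)ˣ → ℕ)
    (ha : ∀ v : (ZMod p)ˣ, p * (a v + 1) = ∑ u : (ZMod p)ˣ, b u * ((u⁻¹ * -v : (ZMod p)ˣ) : ZMod p).val)
    (v : (ZMod p)ˣ) : a v + a (-v) + 2 = ∑ u : (ZMod p)ˣ, b u := by
  have h1 := ha v
  have h2 := ha (-v)
  have h3 := sum_mul_val_add_sum_mul_val_eq b v
  have h4 : p * (a v + a (-v) + 2) = p * ∑ u : (ZMod p)ˣ, b u := by
    rw [← h3, ← h1, ← h2]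
    ring
  exact Nat.eq_of_mul_eq_mul_left hp.out.pos h4

/-- **The total multiplicity of the inverse: `2·Σ_v 𝐚(v) + 2(p−1) = (p−1)·Σ_u 𝐛(u)`**, i.e. `Σ_v 𝐚(v) = (p−1)(Σ𝐛 − 2)/2`
(`|G| = p − 1`, `Σ_{v∈G} 𝐣(v) = p(p−1)/2`). [cite: Zarhin2021PrimeOrderJacobians, §2 Thm. 2.1 (a), (c) (chunk p0006 L40–L60), §1 (1.2) (chunk p0003 L47)] -/
theorem two_mul_sum_add_eq_of_inverse (b a : (ZMod p)ˣ → ℕ)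
    (ha : ∀ v : (ZMod p)ˣ, p * (a v + 1) = ∑ u : (ZMod p)ˣ, b u * ((u⁻¹ * -v : (ZMod p)ˣ) : ZMod p).val) :
    2 * ∑ v : (ZMod p)ˣ, a v + 2 * (p - 1) = (p - 1) * ∑ u : (ZMod p)ˣ, b u := by
  have h1 : p * (∑ v : (ZMod p)ˣ, a v + (p - 1)) =
      ∑ v : (ZMod p)ˣ, ∑ u : (ZMod p)ˣ, b u * ((u⁻¹ * -v : (ZMod p)ˣ) : ZMod p).val := by
    rw [← Finset.sum_congr rfl fun v _ ↦ ha v, ← Finset.mul_sum, Finset.sum_add_distrib, Finset.sum_const, Finset.card_univ,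
      ZMod.card_units_eq_totient, Nat.totient_prime hp.out, smul_eq_mul, mul_one]
  have h2 := sum_sum_mul_val_mul_two b
  rw [← h1] at h2
  -- h2 : p * (Σ a + (p-1)) * 2 = (Σ b) * (p * (p - 1))
  have h3 : p * ((∑ v : (ZMod p)ˣ, a v + (p - 1)) * 2) = p * ((p - 1) * ∑ u : (ZMod p)ˣ, b u) := by
    rw [← mul_assoc, h2]; ring
  have h4 := Nat.eq_of_mul_eq_mul_left hp.out.pos h3
  omega

/-- **Under (i) `Σ_h 𝐛(h) = 2g/(p−1) + 2` (as `(Σ𝐛)(p−1) = 2g + 2(p−1)`): `(𝐚(v) + 𝐚(−v))·(p−1) = 2g`** — the inverse is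
admissible in the sense of Definition 1.1. [cite: Zarhin2021PrimeOrderJacobians, §1 Def. 1.1 (chunk p0003 L74–L80), §2 Thm. 2.1 (i), (c) (chunk p0006 L14–L60)] -/
theorem add_neg_mul_eq_of_inverse {g : ℕ} (b a : (ZMod p)ˣ → ℕ)
    (hi : (∑ u : (ZMod p)ˣ, b u) * (p - 1) = 2 * g + 2 * (p - 1))
    (ha : ∀ v : (ZMod p)ˣ, p * (a v + 1) = ∑ u : (ZMod p)ˣ, b u * ((u⁻¹ * -v : (ZMod p)ˣ) : ZMod p).val)
    (v : (ZMod p)ˣ) : (a v + a (-v)) * (p - 1) = 2 * g := by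
  have h := add_neg_add_two_eq_sum_of_inverse b a ha v
  rw [← h, add_mul] at hi
  omega

/-- **Under (i): `Σ_{v∈G} 𝐚(v) = g`** — the total multiplicity of the inverse is the prescribed dimension (Theorem 2.1 (a) with
(1.2) `Σ_{h∈G} 𝐚(h) = g`). [cite: Zarhin2021PrimeOrderJacobians, §2 Thm. 2.1 (i), (a), (c) (chunk p0006 L14–L60), §1 (1.2) (chunk p0003 L47)] -/
theorem sum_eq_of_inverse {g : ℕ} (b a : (ZMod p)ˣ → ℕ)
    (hi : (∑ u : (ZMod p)ˣ, b u) * (p - 1) = 2 * g + 2 * (p - 1))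
    (ha : ∀ v : (ZMod p)ˣ, p * (a v + 1) = ∑ u : (ZMod p)ˣ, b u * ((u⁻¹ * -v : (ZMod p)ˣ) : ZMod p).val) :
    ∑ v : (ZMod p)ˣ, a v = g := by
  have h := two_mul_sum_add_eq_of_inverse b a ha
  rw [mul_comm (p - 1), hi] at h
  omega

end Inverse

end PrimeOrderRotation

end Literature.AlgebraicGeometry.HodgeTheory
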